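import Literature.ModelTheory.FiniteModelTheory.CohomologicalConsistencyClosure
import Mathlib.Tactic.IntervalCases
import HarnessLib

/-!
# Hops and lassos relative to a closed superset, and uniform hop data
# (for the size lemma of Conneryd–Ghannane–Pang 2025, Lemma 6.7 = [CdRNPR25, Lemma 5.4])

Topic `Literature/ModelTheory/FiniteModelTheory`.  Bottom-up formalisation of the named fact
`connerydGhannanePang2025_thm_6_1`.  Two ingredients of the closure-size argument of [CdRNPR25]
(arXiv:2503.17022, Prop. 24, Alg. 25, Lemma 27):

* "a subgraph of a hop or lasso is again a hop or a lasso" (proof of Prop. 24 / minimality of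
  Alg. 25): if `Q` is a `2,3,4`-hop or lasso with respect to `W` and `W ⊆ W'` with `W'` CLOSED, then
  all vertices of `Q` lie in `W'` (`HasHop2.mem_of_isClosed`, …, `HasLasso.mem_of_isClosed`) —
  the same case analysis as `IsClosed.inter`;
* a UNIFORM PRESENTATION `HopData G W` of the six patterns as a chain `a = b 0 ~ b 1 ~ ⋯ ~ b r`
  (`1 ≤ r ≤ 3`, `b 0 ∈ W`, `b k ∉ W` for `k ≥ 1`, pairwise distinct) plus a CLOSING EDGE
  `b r ~ z` different from the chain edges, with `z ∈ W` (path / cycle hops) or `z = b 1` (lasso);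
  every non-closed descendant-closed set carries one (`exists_hopData`), and its vertices lie in
  any closed superset (`HopData.mem_of_isClosed`).  This is the shape used by the edge-counting
  of Claim 29: `r` new vertices, `r + 1` new edges.

## References

* [ConnerydGhannanePang2025] arXiv:2511.17272 §6 (Def. 6.6, Lemma 6.7). READ.
* [CdRNPR25] arXiv:2503.17022 §5, Prop. 24, Alg. 25, Lemma 27 (Claims 28–29). READ.
-/

namespace Literature.ModelTheory.FiniteModelTheory

namespace ConnerydGhannanePang

open Finset

variable {V : Type*} [LT V] {G : SimpleGraph V} {W W' : Finset V}

/-! ### Hops relative to a closed superset -/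

/-- A `2`-hop w.r.t. `W ⊆ W'`, `W'` closed, lies in `W'`. [cite: ConnerydGhannanePang2025, Def. 6.6 (via [CdRNPR25, Prop. 24])] -/
theorem hop2_mem_of_isClosed (hW' : IsClosed G W') (hWW' : W ⊆ W') {a b c : V} (ha : a ∈ W)
    (hc : c ∈ W) (hac : a ≠ c) (e₁ : G.Adj a b) (e₂ : G.Adj b c) : b ∈ W' := by
  by_contra hb
  exact hW'.no_hop2 (hWW' ha) (hWW' hc) hb hac e₁ e₂

/-- A `3`-hop path w.r.t. `W ⊆ W'`, `W'` closed, lies in `W'`. [cite: ConnerydGhannanePang2025, Def. 6.6 (via [CdRNPR25, Prop. 24])] -/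
theorem hop3Path_mem_of_isClosed (hW' : IsClosed G W') (hWW' : W ⊆ W') {a b₁ b₂ c : V} (ha : a ∈ W)
    (hc : c ∈ W) (hb₁ : b₁ ∉ W) (hb₂ : b₂ ∉ W) (hac : a ≠ c) (e₁ : G.Adj a b₁) (e₂ : G.Adj b₁ b₂)
    (e₃ : G.Adj b₂ c) : b₁ ∈ W' ∧ b₂ ∈ W' := by
  by_cases k₁ : b₁ ∈ W' <;> by_cases k₂ : b₂ ∈ W'
  · exact ⟨k₁, k₂⟩
  · exact (hW'.no_hop2 k₁ (hWW' hc) k₂ (fun h => hb₁ (h ▸ hc)) e₂ e₃).elim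
  · exact (hW'.no_hop2 (hWW' ha) k₂ k₁ (fun h => hb₂ (h ▸ ha)) e₁ e₂).elim
  · exact (hW'.no_hop3Path (hWW' ha) (hWW' hc) k₁ k₂ hac e₁ e₂ e₃).elim

/-- A `3`-hop cycle w.r.t. `W ⊆ W'`, `W'` closed, lies in `W'`. [cite: ConnerydGhannanePang2025, Def. 6.6 (via [CdRNPR25, Prop. 24])] -/
theorem hop3Cycle_mem_of_isClosed (hW' : IsClosed G W') (hWW' : W ⊆ W') {a b₁ b₂ : V} (ha : a ∈ W)
    (hb₁ : b₁ ∉ W) (hb₂ : b₂ ∉ W) (e₁ : G.Adj a b₁) (e₂ : G.Adj b₁ b₂) (e₃ : G.Adj b₂ a) :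
    b₁ ∈ W' ∧ b₂ ∈ W' := by
  by_cases k₁ : b₁ ∈ W' <;> by_cases k₂ : b₂ ∈ W'
  · exact ⟨k₁, k₂⟩
  · exact (hW'.no_hop2 k₁ (hWW' ha) k₂ (fun h => hb₁ (h ▸ ha)) e₂ e₃).elim
  · exact (hW'.no_hop2 (hWW' ha) k₂ k₁ (fun h => hb₂ (h ▸ ha)) e₁ e₂).elim
  · exact (hW'.no_hop3Cycle (hWW' ha) k₁ k₂ e₁ e₂ e₃).elim

/-- A `4`-hop path w.r.t. `W ⊆ W'`, `W'` closed, lies in `W'`. [cite: ConnerydGhannanePang2025, Def. 6.6 (via [CdRNPR25, Prop. 24])] -/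
theorem hop4Path_mem_of_isClosed (hW' : IsClosed G W') (hWW' : W ⊆ W') {a b₁ b₂ b₃ c : V}
    (ha : a ∈ W) (hc : c ∈ W) (hb₁ : b₁ ∉ W) (hb₂ : b₂ ∉ W) (hb₃ : b₃ ∉ W) (hac : a ≠ c)
    (h13 : b₁ ≠ b₃) (e₁ : G.Adj a b₁) (e₂ : G.Adj b₁ b₂) (e₃ : G.Adj b₂ b₃) (e₄ : G.Adj b₃ c) :
    b₁ ∈ W' ∧ b₂ ∈ W' ∧ b₃ ∈ W' := by
  have ha' := hWW' ha
  have hc' := hWW' hc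
  by_cases k₁ : b₁ ∈ W' <;> by_cases k₂ : b₂ ∈ W' <;> by_cases k₃ : b₃ ∈ W'
  · exact ⟨k₁, k₂, k₃⟩
  · exact (hW'.no_hop2 k₂ hc' k₃ (fun h => hb₂ (h ▸ hc)) e₃ e₄).elim
  · exact (hW'.no_hop2 k₁ k₃ k₂ h13 e₂ e₃).elim
  · exact (hW'.no_hop3Path k₁ hc' k₂ k₃ (fun h => hb₁ (h ▸ hc)) e₂ e₃ e₄).elim
  · exact (hW'.no_hop2 ha' k₂ k₁ (fun h => hb₂ (h ▸ ha)) e₁ e₂).elim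
  · exact (hW'.no_hop2 ha' k₂ k₁ (fun h => hb₂ (h ▸ ha)) e₁ e₂).elim
  · exact (hW'.no_hop3Path ha' k₃ k₁ k₂ (fun h => hb₃ (h ▸ ha)) e₁ e₂ e₃).elim
  · exact (hW'.hop4Path ⟨a, b₁, b₂, b₃, c, ha', hc', k₁, k₂, k₃, hac, h13, e₁, e₂, e₃, e₄⟩).elim

/-- A `4`-hop cycle w.r.t. `W ⊆ W'`, `W'` closed, lies in `W'`. [cite: ConnerydGhannanePang2025, Def. 6.6 (via [CdRNPR25, Prop. 24])] -/
theorem hop4Cycle_mem_of_isClosed (hW' : IsClosed G W') (hWW' : W ⊆ W') {a b₁ b₂ b₃ : V}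
    (ha : a ∈ W) (hb₁ : b₁ ∉ W) (hb₂ : b₂ ∉ W) (hb₃ : b₃ ∉ W) (h13 : b₁ ≠ b₃) (e₁ : G.Adj a b₁)
    (e₂ : G.Adj b₁ b₂) (e₃ : G.Adj b₂ b₃) (e₄ : G.Adj b₃ a) : b₁ ∈ W' ∧ b₂ ∈ W' ∧ b₃ ∈ W' := by
  have ha' := hWW' ha
  by_cases k₁ : b₁ ∈ W' <;> by_cases k₂ : b₂ ∈ W' <;> by_cases k₃ : b₃ ∈ W'
  · exact ⟨k₁, k₂, k₃⟩
  · exact (hW'.no_hop2 k₂ ha' k₃ (fun h => hb₂ (h ▸ ha)) e₃ e₄).elim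
  · exact (hW'.no_hop2 k₁ k₃ k₂ h13 e₂ e₃).elim
  · exact (hW'.no_hop3Path k₁ ha' k₂ k₃ (fun h => hb₁ (h ▸ ha)) e₂ e₃ e₄).elim
  · exact (hW'.no_hop2 ha' k₂ k₁ (fun h => hb₂ (h ▸ ha)) e₁ e₂).elim
  · exact (hW'.no_hop2 ha' k₂ k₁ (fun h => hb₂ (h ▸ ha)) e₁ e₂).elim
  · exact (hW'.no_hop3Path ha' k₃ k₁ k₂ (fun h => hb₃ (h ▸ ha)) e₁ e₂ e₃).elim
  · exact (hW'.hop4Cycle ⟨a, b₁, b₂, b₃, ha', k₁, k₂, k₃, h13, e₁, e₂, e₃, e₄⟩).elim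

/-- A lasso w.r.t. `W ⊆ W'`, `W'` closed, lies in `W'`. [cite: ConnerydGhannanePang2025, Def. 6.6 (via [CdRNPR25, Prop. 24])] -/
theorem lasso_mem_of_isClosed (hW' : IsClosed G W') (hWW' : W ⊆ W') {v₁ v₂ v₃ v₄ : V} (hv₁ : v₁ ∈ W)
    (_hv₂ : v₂ ∉ W) (hv₃ : v₃ ∉ W) (hv₄ : v₄ ∉ W) (e₁ : G.Adj v₁ v₂) (e₂ : G.Adj v₂ v₃)
    (e₃ : G.Adj v₃ v₄) (e₄ : G.Adj v₄ v₂) : v₂ ∈ W' ∧ v₃ ∈ W' ∧ v₄ ∈ W' := by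
  have hv₁' := hWW' hv₁
  by_cases k₂ : v₂ ∈ W' <;> by_cases k₃ : v₃ ∈ W' <;> by_cases k₄ : v₄ ∈ W'
  · exact ⟨k₂, k₃, k₄⟩
  · exact (hW'.no_hop2 k₃ k₂ k₄ (G.ne_of_adj e₂).symm e₃ e₄).elim
  · exact (hW'.no_hop2 k₂ k₄ k₃ (G.ne_of_adj e₄).symm e₂ e₃).elim
  · exact (hW'.no_hop3Cycle k₂ k₃ k₄ e₂ e₃ e₄).elim
  · exact (hW'.no_hop2 hv₁' k₃ k₂ (fun h => hv₃ (h ▸ hv₁)) e₁ e₂).elim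
  · exact (hW'.no_hop2 hv₁' k₃ k₂ (fun h => hv₃ (h ▸ hv₁)) e₁ e₂).elim
  · exact (hW'.no_hop2 hv₁' k₄ k₂ (fun h => hv₄ (h ▸ hv₁)) e₁ e₄.symm).elim
  · exact (hW'.lasso ⟨v₁, v₂, v₃, v₄, hv₁', k₂, k₃, k₄, e₁, e₂, e₃, e₄⟩).elim

/-! ### Uniform hop data -/

variable (G W) in
/-- UNIFORM PRESENTATION of a `2,3,4`-hop or lasso w.r.t. `W`: a chain `b 0 ~ b 1 ~ ⋯ ~ b r`,
`1 ≤ r ≤ 3`, with `b 0 ∈ W`, `b k ∉ W` (`1 ≤ k ≤ r`), pairwise distinct on `[0, r]`, and a closing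
edge `b r ~ z`, different from the chain edges, with `z ∈ W` or `z = b 1`.
[cite: ConnerydGhannanePang2025, Lemma 6.7 (via [CdRNPR25, Claim 29])] -/
structure HopData where
  /-- the chain; `b 0` is the base in `W`, `b 1, …, b r` are the inner vertices -/
  b : ℕ → V
  /-- the number of inner vertices -/
  r : ℕ
  /-- the closing vertex -/
  z : V
  one_le : 1 ≤ r
  le_three : r ≤ 3
  base_mem : b 0 ∈ W
  not_mem : ∀ k, 1 ≤ k → k ≤ r → b k ∉ W
  adj : ∀ k < r, G.Adj (b k) (b (k + 1))
  close : G.Adj (b r) z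
  z_mem : z ∈ W ∨ z = b 1
  inj : ∀ j k, j ≤ r → k ≤ r → b j = b k → j = k
  close_ne : ∀ k < r, s(b k, b (k + 1)) ≠ s(b r, z)

namespace HopData

variable (Q : HopData G W)

/-- All vertices of the chain lie in any closed superset of `W`.
[cite: ConnerydGhannanePang2025, Def. 6.6 (via [CdRNPR25, Prop. 24])] -/
theorem mem_of_isClosed (hW' : IsClosed G W') (hWW' : W ⊆ W') : ∀ k ≤ Q.r, Q.b k ∈ W' := by
  -- dispatch on `r` and on the nature of the closing vertex
  have h0 : Q.b 0 ∈ W' := hWW' Q.base_mem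
  have hr := Q.le_three
  have h1 := Q.one_le
  have hb1 : Q.b 1 ∉ W := Q.not_mem 1 le_rfl h1
  intro k hk
  rcases Nat.lt_or_ge Q.r 2 with hr1 | hr2
  · -- `r = 1`: a `2`-hop `b0 ~ b1 ~ z` (`z ∈ W`, `z ≠ b0`) — `z = b 1` is impossible (loop)
    have hr1 : Q.r = 1 := le_antisymm (Nat.lt_succ_iff.1 hr1) h1
    rcases Q.z_mem with hz | hz
    · have hne : Q.b 0 ≠ Q.z := by
        intro h
        apply Q.close_ne 0 (by omega)
        rw [zero_add, h, hr1, Sym2.eq_swap]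
      have hb1' : Q.b 1 ∈ W' :=
        hop2_mem_of_isClosed hW' hWW' Q.base_mem hz hne (Q.adj 0 (by omega)) (hr1 ▸ Q.close)
      have hk1 : k ≤ 1 := hr1 ▸ hk
      interval_cases k
      · exact h0
      · exact hb1'
    · exact absurd (hr1 ▸ hz ▸ Q.close) (G.loopless.irrefl _)
  rcases Nat.lt_or_ge Q.r 3 with hr2' | hr3
  · -- `r = 2`
    have hr2 : Q.r = 2 := by omega
    have hb2 : Q.b 2 ∉ W := Q.not_mem 2 (by omega) (by omega)
    have e₁ := Q.adj 0 (by omega)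
    have e₂ := Q.adj 1 (by omega)
    have e₃ : G.Adj (Q.b 2) Q.z := hr2 ▸ Q.close
    have hk2 : k ≤ 2 := hr2 ▸ hk
    rcases Q.z_mem with hz | hz
    · by_cases hze : Q.z = Q.b 0
      · -- `3`-cycle through `b 0`
        obtain ⟨k1, k2⟩ := hop3Cycle_mem_of_isClosed hW' hWW' Q.base_mem hb1 hb2 e₁ e₂ (hze ▸ e₃)
        interval_cases k <;> assumption
      · obtain ⟨k1, k2⟩ :=
          hop3Path_mem_of_isClosed hW' hWW' Q.base_mem hz hb1 hb2 (Ne.symm hze) e₁ e₂ e₃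
        interval_cases k <;> assumption
    · -- closing back to `b 1` with `r = 2`: the closing edge would be the chain edge `b1 ~ b2`
      exact absurd (by rw [hr2, hz, Sym2.eq_swap]) (Q.close_ne 1 (by omega))
  · -- `r = 3`
    have hr3 : Q.r = 3 := le_antisymm hr hr3
    have hb2 : Q.b 2 ∉ W := Q.not_mem 2 (by omega) (by omega)
    have hb3 : Q.b 3 ∉ W := Q.not_mem 3 (by omega) (by omega)
    have e₁ := Q.adj 0 (by omega)
    have e₂ := Q.adj 1 (by omega)
    have e₃ := Q.adj 2 (by omega)
    have e₄ : G.Adj (Q.b 3) Q.z := hr3 ▸ Q.close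
    have h13 : Q.b 1 ≠ Q.b 3 := fun h => by have := Q.inj 1 3 (by omega) (by omega) h; omega
    have hk3 : k ≤ 3 := hr3 ▸ hk
    rcases Q.z_mem with hz | hz
    · by_cases hze : Q.z = Q.b 0
      · obtain ⟨k1, k2, k3⟩ :=
          hop4Cycle_mem_of_isClosed hW' hWW' Q.base_mem hb1 hb2 hb3 h13 e₁ e₂ e₃ (hze ▸ e₄)
        interval_cases k <;> assumption
      · obtain ⟨k1, k2, k3⟩ :=
          hop4Path_mem_of_isClosed hW' hWW' Q.base_mem hz hb1 hb2 hb3 (Ne.symm hze) h13 e₁ e₂ e₃ e₄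
        interval_cases k <;> assumption
    · -- lasso: `b0 ; b1 ~ b2 ~ b3 ~ b1`
      obtain ⟨k1, k2, k3⟩ := lasso_mem_of_isClosed hW' hWW' Q.base_mem hb1 hb2 hb3 e₁ e₂ e₃ (hz ▸ e₄)
      interval_cases k <;> assumption

/-- The closing vertex lies in any closed superset of `W`. [folklore] -/
theorem z_mem_of_isClosed (hW' : IsClosed G W') (hWW' : W ⊆ W') : Q.z ∈ W' := by
  rcases Q.z_mem with hz | hz
  · exact hWW' hz
  · rw [hz]; exact Q.mem_of_isClosed hW' hWW' 1 Q.one_le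

end HopData

/-! ### Every non-closed descendant-closed set carries hop data -/

section Exists

variable (G W)

omit [LT V] in
/-- Hop data from a `2`-hop. [folklore] -/
theorem hopData_of_hop2 (h : HasHop2 G W) : Nonempty (HopData G W) := by
  obtain ⟨a, b₁, c, ha, hc, hb₁, hac, e₁, e₂⟩ := h
  have n01 : a ≠ b₁ := G.ne_of_adj e₁
  have n1z : b₁ ≠ c := G.ne_of_adj e₂
  have n0z : a ≠ c := hac
  refine ⟨⟨fun k => if k = 0 then a else b₁, 1, c, le_rfl, by omega, by simpa using ha, ?_, ?_,
    by simpa using e₂, Or.inl hc, ?_, ?_⟩⟩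
  · intro k hk1 hk; interval_cases k; simpa using hb₁
  · intro k hk; interval_cases k; simpa using e₁
  · intro j k hj hk hjk
    interval_cases j <;> interval_cases k <;> simp at hjk ⊢ <;> first | exact absurd hjk n01 | exact absurd hjk n01.symm
  · intro k hk; interval_cases k; rw [Ne, Sym2.eq_iff]
    rintro (⟨h, h'⟩ | ⟨h, h'⟩) <;> simp at h h' <;> first | exact n01 h | exact n01 h.symm | exact n1z h' | exact n1z h'.symm | exact n0z h

omit [LT V] in
/-- Hop data from a `3`-hop path. [folklore] -/
theorem hopData_of_hop3Path (h : HasHop3Path G W) : Nonempty (HopData G W) := by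
  obtain ⟨a, b₁, b₂, c, ha, hc, hb₁, hb₂, hac, e₁, e₂, e₃⟩ := h
  have n01 : a ≠ b₁ := G.ne_of_adj e₁
  have n12 : b₁ ≠ b₂ := G.ne_of_adj e₂
  have n2z : b₂ ≠ c := G.ne_of_adj e₃
  have n02 : a ≠ b₂ := fun h => hb₂ (h ▸ ha)
  have n1z : b₁ ≠ c := fun h => hb₁ (h ▸ hc)
  have n0z : a ≠ c := hac
  refine ⟨⟨fun k => if k = 0 then a else if k = 1 then b₁ else b₂, 2, c, by omega, by omega,
    by simpa using ha, ?_, ?_, by simpa using e₃, Or.inl hc, ?_, ?_⟩⟩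
  · intro k hk1 hk; interval_cases k <;> simp [hb₁, hb₂]
  · intro k hk; interval_cases k <;> simp [e₁, e₂]
  · intro j k hj hk hjk
    interval_cases j <;> interval_cases k <;> simp at hjk ⊢ <;> first | exact absurd hjk n01 | exact absurd hjk n01.symm | exact absurd hjk n12 | exact absurd hjk n12.symm | exact absurd hjk n02 | exact absurd hjk n02.symm
  · intro k hk
    interval_cases k <;> rw [Ne, Sym2.eq_iff] <;> rintro (⟨h, h'⟩ | ⟨h, h'⟩) <;> simp at h h' <;> first | exact n01 h | exact n01 h.symm | exact n01 h' | exact n01 h'.symm | exact n12 h | exact n12 h.symm | exact n12 h' | exact n12 h'.symm | exact n02 h | exact n02 h.symm | exact n02 h' | exact n02 h'.symm | exact n0z h | exact n0z h.symm | exact n0z h' | exact n0z h'.symm | exact n1z h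

omit [LT V] in
/-- Hop data from a `3`-hop cycle. [folklore] -/
theorem hopData_of_hop3Cycle (h : HasHop3Cycle G W) : Nonempty (HopData G W) := by
  obtain ⟨a, b₁, b₂, ha, hb₁, hb₂, e₁, e₂, e₃⟩ := h
  have n01 : a ≠ b₁ := G.ne_of_adj e₁
  have n12 : b₁ ≠ b₂ := G.ne_of_adj e₂
  have n02 : a ≠ b₂ := fun h => hb₂ (h ▸ ha)
  have n2z : b₂ ≠ a := n02.symm
  have n1z : b₁ ≠ a := n01.symm
  have n0z : b₁ ≠ b₂ := n12
  refine ⟨⟨fun k => if k = 0 then a else if k = 1 then b₁ else b₂, 2, a, by omega, by omega,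
    by simpa using ha, ?_, ?_, by simpa using e₃, Or.inl ha, ?_, ?_⟩⟩
  · intro k hk1 hk; interval_cases k <;> simp [hb₁, hb₂]
  · intro k hk; interval_cases k <;> simp [e₁, e₂]
  · intro j k hj hk hjk
    interval_cases j <;> interval_cases k <;> simp at hjk ⊢ <;> first | exact absurd hjk n01 | exact absurd hjk n01.symm | exact absurd hjk n12 | exact absurd hjk n12.symm | exact absurd hjk n02 | exact absurd hjk n02.symm
  · intro k hk
    interval_cases k <;> rw [Ne, Sym2.eq_iff] <;> rintro (⟨h, h'⟩ | ⟨h, h'⟩) <;> simp at h h' <;> first | exact n01 h | exact n01 h.symm | exact n01 h' | exact n01 h'.symm | exact n12 h | exact n12 h.symm | exact n12 h'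

omit [LT V] in
/-- Hop data from a `4`-hop path. [folklore] -/
theorem hopData_of_hop4Path (h : HasHop4Path G W) : Nonempty (HopData G W) := by
  obtain ⟨a, b₁, b₂, b₃, c, ha, hc, hb₁, hb₂, hb₃, hac, h13, e₁, e₂, e₃, e₄⟩ := h
  have n01 : a ≠ b₁ := G.ne_of_adj e₁
  have n12 : b₁ ≠ b₂ := G.ne_of_adj e₂
  have n23 : b₂ ≠ b₃ := G.ne_of_adj e₃
  have n3z : b₃ ≠ c := G.ne_of_adj e₄
  have n02 : a ≠ b₂ := fun h => hb₂ (h ▸ ha)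
  have n03 : a ≠ b₃ := fun h => hb₃ (h ▸ ha)
  have n13 : b₁ ≠ b₃ := h13
  have n1z : b₁ ≠ c := fun h => hb₁ (h ▸ hc)
  have n2z : b₂ ≠ c := fun h => hb₂ (h ▸ hc)
  have n0z : a ≠ c := hac
  refine ⟨⟨fun k => if k = 0 then a else if k = 1 then b₁ else if k = 2 then b₂ else b₃, 3, c,
    by omega, le_rfl, by simpa using ha, ?_, ?_, by simpa using e₄, Or.inl hc, ?_, ?_⟩⟩
  · intro k hk1 hk; interval_cases k <;> simp [hb₁, hb₂, hb₃]
  · intro k hk; interval_cases k <;> simp [e₁, e₂, e₃]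
  · intro j k hj hk hjk
    interval_cases j <;> interval_cases k <;> simp at hjk ⊢ <;> first | exact absurd hjk n01 | exact absurd hjk n01.symm | exact absurd hjk n12 | exact absurd hjk n12.symm | exact absurd hjk n02 | exact absurd hjk n02.symm | exact absurd hjk n23 | exact absurd hjk n23.symm | exact absurd hjk n03 | exact absurd hjk n03.symm | exact absurd hjk n13 | exact absurd hjk n13.symm
  · intro k hk
    interval_cases k <;> rw [Ne, Sym2.eq_iff] <;> rintro (⟨h, h'⟩ | ⟨h, h'⟩) <;> simp at h h' <;> first | exact n01 h | exact n01 h.symm | exact n01 h' | exact n01 h'.symm | exact n12 h | exact n12 h.symm | exact n12 h' | exact n12 h'.symm | exact n02 h | exact n02 h.symm | exact n02 h' | exact n02 h'.symm | exact n0z h | exact n0z h.symm | exact n0z h' | exact n0z h'.symm | exact n1z h | exact n1z h.symm | exact n1z h' | exact n1z h'.symm | exact n2z h | exact n2z h.symm | exact n2z h' | exact n2z h'.symm | exact n23 h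

omit [LT V] in
/-- Hop data from a `4`-hop cycle. [folklore] -/
theorem hopData_of_hop4Cycle (h : HasHop4Cycle G W) : Nonempty (HopData G W) := by
  obtain ⟨a, b₁, b₂, b₃, ha, hb₁, hb₂, hb₃, h13, e₁, e₂, e₃, e₄⟩ := h
  have n01 : a ≠ b₁ := G.ne_of_adj e₁
  have n12 : b₁ ≠ b₂ := G.ne_of_adj e₂
  have n23 : b₂ ≠ b₃ := G.ne_of_adj e₃
  have n02 : a ≠ b₂ := fun h => hb₂ (h ▸ ha)
  have n03 : a ≠ b₃ := fun h => hb₃ (h ▸ ha)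
  have n13 : b₁ ≠ b₃ := h13
  have n3z : b₃ ≠ a := n03.symm
  have n1z : b₁ ≠ a := n01.symm
  have n2z : b₂ ≠ a := n02.symm
  have n0z : b₁ ≠ b₃ := h13
  refine ⟨⟨fun k => if k = 0 then a else if k = 1 then b₁ else if k = 2 then b₂ else b₃, 3, a,
    by omega, le_rfl, by simpa using ha, ?_, ?_, by simpa using e₄, Or.inl ha, ?_, ?_⟩⟩
  · intro k hk1 hk; interval_cases k <;> simp [hb₁, hb₂, hb₃]
  · intro k hk; interval_cases k <;> simp [e₁, e₂, e₃]
  · intro j k hj hk hjk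
    interval_cases j <;> interval_cases k <;> simp at hjk ⊢ <;> first | exact absurd hjk n01 | exact absurd hjk n01.symm | exact absurd hjk n12 | exact absurd hjk n12.symm | exact absurd hjk n02 | exact absurd hjk n02.symm | exact absurd hjk n23 | exact absurd hjk n23.symm | exact absurd hjk n03 | exact absurd hjk n03.symm | exact absurd hjk n13 | exact absurd hjk n13.symm
  · intro k hk
    interval_cases k <;> rw [Ne, Sym2.eq_iff] <;> rintro (⟨h, h'⟩ | ⟨h, h'⟩) <;> simp at h h' <;> first | exact n01 h | exact n01 h.symm | exact n01 h' | exact n01 h'.symm | exact n12 h | exact n12 h.symm | exact n12 h' | exact n12 h'.symm | exact n02 h | exact n02 h.symm | exact n02 h' | exact n02 h'.symm | exact n0z h | exact n0z h.symm | exact n0z h' | exact n0z h'.symm | exact n1z h | exact n1z h.symm | exact n1z h' | exact n1z h'.symm | exact n2z h | exact n2z h.symm | exact n2z h' | exact n2z h'.symm | exact n23 h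

omit [LT V] in
/-- Hop data from a lasso. [folklore] -/
theorem hopData_of_lasso (h : HasLasso G W) : Nonempty (HopData G W) := by
  obtain ⟨a, b₁, b₂, b₃, ha, hb₁, hb₂, hb₃, e₁, e₂, e₃, e₄⟩ := h
  have n01 : a ≠ b₁ := G.ne_of_adj e₁
  have n12 : b₁ ≠ b₂ := G.ne_of_adj e₂
  have n23 : b₂ ≠ b₃ := G.ne_of_adj e₃
  have n13 : b₁ ≠ b₃ := fun h => G.loopless.irrefl _ (h ▸ e₄)
  have n02 : a ≠ b₂ := fun h => hb₂ (h ▸ ha)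
  have n03 : a ≠ b₃ := fun h => hb₃ (h ▸ ha)
  have n3z : b₃ ≠ b₁ := n13.symm
  have n2z : b₂ ≠ b₁ := n12.symm
  have n0z : a ≠ b₁ := n01
  have n1z : b₂ ≠ b₃ := n23
  refine ⟨⟨fun k => if k = 0 then a else if k = 1 then b₁ else if k = 2 then b₂ else b₃, 3, b₁,
    by omega, le_rfl, by simpa using ha, ?_, ?_, by simpa using e₄, Or.inr (by simp), ?_, ?_⟩⟩
  · intro k hk1 hk; interval_cases k <;> simp [hb₁, hb₂, hb₃]
  · intro k hk; interval_cases k <;> simp [e₁, e₂, e₃]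
  · intro j k hj hk hjk
    interval_cases j <;> interval_cases k <;> simp at hjk ⊢ <;> first | exact absurd hjk n01 | exact absurd hjk n01.symm | exact absurd hjk n12 | exact absurd hjk n12.symm | exact absurd hjk n02 | exact absurd hjk n02.symm | exact absurd hjk n23 | exact absurd hjk n23.symm | exact absurd hjk n03 | exact absurd hjk n03.symm | exact absurd hjk n13 | exact absurd hjk n13.symm
  · intro k hk
    interval_cases k <;> rw [Ne, Sym2.eq_iff] <;> rintro (⟨h, h'⟩ | ⟨h, h'⟩) <;> simp at h h' <;> first | exact n01 h | exact n01 h.symm | exact n01 h' | exact n01 h'.symm | exact n12 h | exact n12 h.symm | exact n12 h' | exact n12 h'.symm | exact n02 h | exact n02 h.symm | exact n02 h' | exact n02 h'.symm | exact n0z h | exact n0z h.symm | exact n0z h' | exact n0z h'.symm | exact n1z h | exact n1z h.symm | exact n1z h' | exact n1z h'.symm | exact n2z h | exact n2z h.symm | exact n2z h' | exact n2z h'.symm | exact n23 h | exact n23 h.symm | exact n23 h' | exact n23 h'.symm | exact n03 h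

variable {G W}

/-- **A descendant-closed set that is not closed carries hop data.** [cite: ConnerydGhannanePang2025, Def. 6.6 (via [CdRNPR25, Alg. 25])] -/
theorem exists_hopData (hdesc : IsDescClosed G W) (h : ¬ IsClosed G W) : Nonempty (HopData G W) := by
  by_contra hno
  refine h ⟨hdesc, fun hh => hno (hopData_of_hop2 G W hh), fun hh => hno (hopData_of_hop3Path G W hh),
    fun hh => hno (hopData_of_hop3Cycle G W hh), fun hh => hno (hopData_of_hop4Path G W hh),
    fun hh => hno (hopData_of_hop4Cycle G W hh), fun hh => hno (hopData_of_lasso G W hh)⟩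

end Exists

end ConnerydGhannanePang

end Literature.ModelTheory.FiniteModelTheory
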